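import Summits.RiemannHypothesis.RiemannHypothesis.Theorems.PfPersistenceRatioClusterReady
import Summits.RiemannHypothesis.RiemannHypothesis.Theorems.PfPersistenceEigenspaceTolerance
import HarnessLib

/-!
# PF persistence — the MODULUS-RATIO conjunct `|ε₁| ≤ κ|ε₂|` (engine-B `g₁ ≥ 1 − κ`): finite-stage W2 and dial
isolation in the `∀`-window class, modulo `ClusterReady` only
(pub-rhpf barrier-prover gen 5, file 6; CASE-DAG leaf G1.21b / §6 PINCER `(Z)`-cell; cand-11 cell I1)

**HONEST FRAMING. This is a long-odds MECHANISM / RIGIDITY campaign; no RH claims.** RH-free linear algebra and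
dial-space bookkeeping; `ζ`'s Weil positivity is never assumed or concluded; `ClusterBinders` / `ClusterReady` are
HYPOTHESES (DATA PF-N2 / PF-C7 / R-PF3a).

## What is proved

Files 1–5 treated the GAUGE-ratio conjunct `|ε₁| ≤ τ(ε₂ − ε₁)` along window sequences; the engine's cell I1
(cand-11) is the MODULUS-ratio conjunct `|ε₁| ≤ κ|ε₂|` (`g₁ = 1 − |ε₁/ε₂| ≥ 1 − κ`, `κ = 0.9` in the records),
for which file 1 proved only the one-window rejection `dial_not_mem_modulusRatioAt`. This file completes the
modulus side:

* §0 `pos_of_orth_pair` — two nonzero orthogonal vectors force dimension `≥ 2` (`0 < N`), so the dimension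
  guard of the modulus lemmas is discharged by the plane itself.
* §1 `ModulusRatioClass κ := {d | ∀ w, |ε₁(d; w)| ≤ κ|ε₂(d; w)|}`.
* §2 `dial_not_mem_modulusRatioAt_of_amplitude` / `…_neg` — one window, amplitude form: plane of `ζ`-height
  `≤ η₂`, pattern cap `c′` on it, low vector (`η`) with pattern floor `ρ` (resp. `≤ −ρ`): every amplitude with
  `κη₂ + η < |t|·(ρ − κc′)` is rejected.
* §3 `upDial_not_mem_modulusRatioClass` (modulo `ClusterBinders q W ρ C`, condition `κC < ρ`),
  `downDial_not_mem_modulusRatioClass` (`ClusterBindersNeg`), the cap-free forms `…_light` (`κ < ρ`) and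
  `…_of_clusterReady` (modulo `ClusterReady q ρ` only), `dial_mem_modulusRatioClass_imp_trivial_of_clusterReady`.
  NOTE for I1 (`κ = 0.9`): the cap-free condition `κ < ρ` asks a pattern floor `> 0.9` on a low vector, i.e. a
  normalised autocorrelation of the low profile at lag `log q` above `0.9` — plausible only when `log q` is small
  against the profile's width (DATA, not claimed); otherwise the binder form `κC < ρ` with the TRUE compression
  cap `C` of `Θ_q` on `ζ`'s low plane is the relevant one.
* §4 `uniformlyRobustAt_strictModulusRatio`, `not_separates_of_strictModulusRatio_subset` — finite-stage W2
  for strict modulus-ratio classes, UNCONDITIONAL (tally wall); `zeta_mem_modulusRatioClass_of_separates`.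
* §5 THE PINCER CONJUNCTION AT FINITE STAGES (`shape ∧ scale`, §6 PINCER row): the eigenspace-tolerance SHAPE
  face (`esToleranceClass ζ W τ_s`, gen 4, robust within the dial space) ∧ a strict gauge- or modulus-ratio stage
  is robust within the dial space (`RobustWithin.inter`), hence never separates —
  `not_separates_of_esTolerance_inter_strictGaugeRatio`, `not_separates_of_esTolerance_inter_strictModulusRatio`
  (UNCONDITIONAL, dichotomy-carried). AS WORDED (all windows) the conjunction inherits §3's dial isolation and
  file 4's soundness from its scale conjunct.

References: the cell files cited by name; R. Courant, D. Hilbert, Methods of Mathematical Physics I, §I.4.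
-/

set_option linter.dupNamespace false

noncomputable section

open Real Set Matrix

namespace Summit.RiemannHypothesis.RiemannHypothesis.Theorems.PfPersistence

/-! ## §0 A plane forces dimension `≥ 2` -/

/-- PROVED: two nonzero orthogonal vectors in `ℝ^{n+1}` force `0 < n`. [folklore] -/
theorem pos_of_orth_pair {n : ℕ} {x y : Fin (n + 1) → ℝ} (hx : x ≠ 0) (hy : y ≠ 0) (hxy : y ⬝ᵥ x = 0) :
    0 < n := by
  rcases Nat.eq_zero_or_pos n with rfl | h
  · exfalso
    have h0 : y ⬝ᵥ x = y 0 * x 0 := by simp [dotProduct]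
    rw [h0] at hxy
    rcases mul_eq_zero.1 hxy with h1 | h1
    · exact hy (funext fun i => by fin_cases i; simpa using h1)
    · exact hx (funext fun i => by fin_cases i; simpa using h1)
  · exact h

/-! ## §1 The `∀`-window modulus-ratio class -/

/-- the `∀`-window MODULUS-RATIO class: `|ε₁(d; w)| ≤ κ|ε₂(d; w)|` at EVERY window (engine-B `g₁ ≥ 1 − κ`,
cand-11 cell I1 AS WORDED). [folklore] -/
def ModulusRatioClass (κ : ℝ) : Set Datum := {d | ∀ win, d ∈ modulusRatioAt κ win}

/-- PROVED: the class lies inside each of its conjuncts. [folklore] -/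
theorem modulusRatioClass_subset (κ : ℝ) (win : Window) : ModulusRatioClass κ ⊆ modulusRatioAt κ win :=
  fun _ hd => hd win

/-! ## §2 One window, amplitude form -/

/-- **PROVED — UP-DIAL MODULUS REJECTION, amplitude form.** Plane `{x, y}` of `ζ`-height `≤ η₂` (`η₂ ≥ 0`) with
pattern cap `−Θ_q ≤ c′` (`c′ ≥ 0`) on it; `v₀ ≠ 0` of `ζ`-height `≤ η` with pattern value `≥ ρ·v₀ᵀv₀`; then every
`t = 2(K − 1)w(q) > 0` with `κη₂ + η < t·(ρ − κc′)` (`0 ≤ κ < 1`) puts the dial outside `modulusRatioAt κ w`.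
[folklore] -/
theorem dial_not_mem_modulusRatioAt_of_amplitude {q : ℕ} {win : Window} (hq : q ∈ primeRange (2 * win.a))
    {K : ℝ} {x y : Fin (win.N + 1) → ℝ} (hx : x ≠ 0) (hy : y ≠ 0) (hxy : y ⬝ᵥ x = 0) {η₂ c' : ℝ}
    (hη₂ : 0 ≤ η₂) (hc' : 0 ≤ c')
    (hZ : ∀ α β : ℝ, (α • x + β • y) ⬝ᵥ (zetaDatum win *ᵥ (α • x + β • y))
      ≤ η₂ * ((α • x + β • y) ⬝ᵥ (α • x + β • y)))
    (hΘ : ∀ α β : ℝ, -((α • x + β • y) ⬝ᵥ (primePattern q win *ᵥ (α • x + β • y)))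
      ≤ c' * ((α • x + β • y) ⬝ᵥ (α • x + β • y)))
    {v₀ : Fin (win.N + 1) → ℝ} (hv₀ : v₀ ≠ 0) {η ρ : ℝ}
    (hZv : v₀ ⬝ᵥ (zetaDatum win *ᵥ v₀) ≤ η * (v₀ ⬝ᵥ v₀))
    (hρ : ρ * (v₀ ⬝ᵥ v₀) ≤ v₀ ⬝ᵥ (primePattern q win *ᵥ v₀))
    {κ : ℝ} (hκ0 : 0 ≤ κ) (hκ : κ < 1) (ht : 0 < 2 * (K - 1) * zetaWeights q)
    (hamp : κ * η₂ + η < 2 * (K - 1) * zetaWeights q * (ρ - κ * c')) :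
    datumOf (dial q K zetaWeights) ∉ modulusRatioAt κ win := by
  set t : ℝ := 2 * (K - 1) * zetaWeights q with ht_def
  have hN : 0 < win.N := pos_of_orth_pair hx hy hxy
  have hκc : 0 ≤ t * (κ * c') := mul_nonneg ht.le (mul_nonneg hκ0 hc')
  have hκη : 0 ≤ κ * η₂ := mul_nonneg hκ0 hη₂
  refine dial_not_mem_modulusRatioAt hN hq hx hy hxy hZ (c := t * c') (fun α β => ?_) hv₀ (η := η) (p := t * ρ)
    (by nlinarith) hZv (by nlinarith) hκ0 hκ (by nlinarith)
  have := hΘ α β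
  nlinarith [dotProduct_self_nonneg_real (α • x + β • y)]

/-- **PROVED — DOWN-DIAL MODULUS REJECTION, amplitude form:** pattern `≤ c′` on the plane, pattern value
`≤ −ρ·v₀ᵀv₀` on the low vector; every `t < 0` with `κη₂ + η < (−t)·(ρ − κc′)` is rejected. [folklore] -/
theorem dial_not_mem_modulusRatioAt_of_amplitude_neg {q : ℕ} {win : Window} (hq : q ∈ primeRange (2 * win.a))
    {K : ℝ} {x y : Fin (win.N + 1) → ℝ} (hx : x ≠ 0) (hy : y ≠ 0) (hxy : y ⬝ᵥ x = 0) {η₂ c' : ℝ}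
    (hη₂ : 0 ≤ η₂) (hc' : 0 ≤ c')
    (hZ : ∀ α β : ℝ, (α • x + β • y) ⬝ᵥ (zetaDatum win *ᵥ (α • x + β • y))
      ≤ η₂ * ((α • x + β • y) ⬝ᵥ (α • x + β • y)))
    (hΘ : ∀ α β : ℝ, (α • x + β • y) ⬝ᵥ (primePattern q win *ᵥ (α • x + β • y))
      ≤ c' * ((α • x + β • y) ⬝ᵥ (α • x + β • y)))
    {v₀ : Fin (win.N + 1) → ℝ} (hv₀ : v₀ ≠ 0) {η ρ : ℝ}
    (hZv : v₀ ⬝ᵥ (zetaDatum win *ᵥ v₀) ≤ η * (v₀ ⬝ᵥ v₀))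
    (hρ : v₀ ⬝ᵥ (primePattern q win *ᵥ v₀) ≤ -ρ * (v₀ ⬝ᵥ v₀))
    {κ : ℝ} (hκ0 : 0 ≤ κ) (hκ : κ < 1) (ht : 2 * (K - 1) * zetaWeights q < 0)
    (hamp : κ * η₂ + η < -(2 * (K - 1) * zetaWeights q) * (ρ - κ * c')) :
    datumOf (dial q K zetaWeights) ∉ modulusRatioAt κ win := by
  set t : ℝ := 2 * (K - 1) * zetaWeights q with ht_def
  have hN : 0 < win.N := pos_of_orth_pair hx hy hxy
  have ht' : 0 < -t := by linarith
  have hκc : 0 ≤ -t * (κ * c') := mul_nonneg ht'.le (mul_nonneg hκ0 hc')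
  have hκη : 0 ≤ κ * η₂ := mul_nonneg hκ0 hη₂
  refine dial_not_mem_modulusRatioAt hN hq hx hy hxy hZ (c := -t * c') (fun α β => ?_) hv₀ (η := η)
    (p := -t * ρ) (by nlinarith) hZv (by nlinarith [dotProduct_self_nonneg_real v₀]) hκ0 hκ (by nlinarith)
  have := hΘ α β
  nlinarith [dotProduct_self_nonneg_real (α • x + β • y)]

/-! ## §3 The `∀`-window class: dial isolation modulo the typed binders -/

/-- **PROVED — UP-DIAL ISOLATION IN `ModulusRatioClass κ` MODULO `ClusterBinders q W ρ C`:** if `0 ≤ κ < 1` and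
`κC < ρ`, no up-dial of `ζ` at `q` (amplitude `t > 0`) lies in the class. [folklore] -/
theorem upDial_not_mem_modulusRatioClass {q : ℕ} {W : ℕ → Window} {ρ C : ℝ} (hB : ClusterBinders q W ρ C)
    {κ : ℝ} (hκ0 : 0 ≤ κ) (hκ : κ < 1) (hκC : κ * C < ρ) {K : ℝ} (ht : 0 < 2 * (K - 1) * zetaWeights q) :
    datumOf (dial q K zetaWeights) ∉ ModulusRatioClass κ := by
  set t : ℝ := 2 * (K - 1) * zetaWeights q with ht_def
  have hgap : 0 < t * (ρ - κ * C) := mul_pos ht (by linarith)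
  obtain ⟨n, x, y, v₀, hx, hy, hxy, hv₀, hZ, hΘ, hZv, hρ⟩ := hB.small (t * (ρ - κ * C) / 4) (by positivity)
  intro hmem
  refine dial_not_mem_modulusRatioAt_of_amplitude (hB.reaches n) hx hy hxy (by positivity) hB.cap_nonneg hZ hΘ
    hv₀ hZv hρ hκ0 hκ ht ?_ (hmem (W n))
  nlinarith

/-- **PROVED — DOWN-DIAL ISOLATION IN `ModulusRatioClass κ` MODULO `ClusterBindersNeg q W ρ C`.** [folklore] -/
theorem downDial_not_mem_modulusRatioClass {q : ℕ} {W : ℕ → Window} {ρ C : ℝ} (hB : ClusterBindersNeg q W ρ C)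
    {κ : ℝ} (hκ0 : 0 ≤ κ) (hκ : κ < 1) (hκC : κ * C < ρ) {K : ℝ} (ht : 2 * (K - 1) * zetaWeights q < 0) :
    datumOf (dial q K zetaWeights) ∉ ModulusRatioClass κ := by
  set t : ℝ := 2 * (K - 1) * zetaWeights q with ht_def
  have ht' : 0 < -t := by linarith
  have hgap : 0 < -t * (ρ - κ * C) := mul_pos ht' (by linarith)
  obtain ⟨n, x, y, v₀, hx, hy, hxy, hv₀, hZ, hΘ, hZv, hρ⟩ := hB.small (-t * (ρ - κ * C) / 4) (by positivity)
  intro hmem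
  refine dial_not_mem_modulusRatioAt_of_amplitude_neg (hB.reaches n) hx hy hxy (by positivity) hB.cap_nonneg hZ
    hΘ hv₀ hZv hρ hκ0 hκ ht ?_ (hmem (W n))
  nlinarith

/-- **PROVED — cap-free form (up-dials):** modulo `ClusterBindersLight q W ρ`, condition `κ < ρ`. [folklore] -/
theorem upDial_not_mem_modulusRatioClass_light {q : ℕ} {W : ℕ → Window} {ρ : ℝ} (hB : ClusterBindersLight q W ρ)
    {κ : ℝ} (hκ0 : 0 ≤ κ) (hκ : κ < 1) (hκρ : κ < ρ) {K : ℝ} (ht : 0 < 2 * (K - 1) * zetaWeights q) :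
    datumOf (dial q K zetaWeights) ∉ ModulusRatioClass κ :=
  upDial_not_mem_modulusRatioClass hB.toClusterBinders hκ0 hκ (by linarith) ht

/-- **PROVED — cap-free form (down-dials):** modulo `ClusterBindersNegLight q W ρ`, `κ < ρ`. [folklore] -/
theorem downDial_not_mem_modulusRatioClass_light {q : ℕ} {W : ℕ → Window} {ρ : ℝ}
    (hB : ClusterBindersNegLight q W ρ) {κ : ℝ} (hκ0 : 0 ≤ κ) (hκ : κ < 1) (hκρ : κ < ρ) {K : ℝ}
    (ht : 2 * (K - 1) * zetaWeights q < 0) : datumOf (dial q K zetaWeights) ∉ ModulusRatioClass κ :=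
  downDial_not_mem_modulusRatioClass hB.toClusterBindersNeg hκ0 hκ (by linarith) ht

/-- **PROVED — UP-DIAL ISOLATION IN `ModulusRatioClass κ` MODULO `ClusterReady q ρ` ONLY** (`0 ≤ κ < 1`,
`κ < ρ`). [folklore] -/
theorem upDial_not_mem_modulusRatioClass_of_clusterReady {q : ℕ} {ρ : ℝ} (h : ClusterReady q ρ) {κ : ℝ}
    (hκ0 : 0 ≤ κ) (hκ : κ < 1) (hκρ : κ < ρ) {K : ℝ} (ht : 0 < 2 * (K - 1) * zetaWeights q) :
    datumOf (dial q K zetaWeights) ∉ ModulusRatioClass κ := by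
  obtain ⟨W, hW⟩ := h.exists_clusterBindersLight
  exact upDial_not_mem_modulusRatioClass_light hW hκ0 hκ hκρ ht

/-- **PROVED — DOWN-DIAL ISOLATION MODULO `ClusterReadyNeg q ρ` ONLY.** [folklore] -/
theorem downDial_not_mem_modulusRatioClass_of_clusterReadyNeg {q : ℕ} {ρ : ℝ} (h : ClusterReadyNeg q ρ) {κ : ℝ}
    (hκ0 : 0 ≤ κ) (hκ : κ < 1) (hκρ : κ < ρ) {K : ℝ} (ht : 2 * (K - 1) * zetaWeights q < 0) :
    datumOf (dial q K zetaWeights) ∉ ModulusRatioClass κ := by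
  obtain ⟨W, hW⟩ := h.exists_clusterBindersNegLight
  exact downDial_not_mem_modulusRatioClass_light hW hκ0 hκ hκρ ht

/-- **PROVED — BOTH SIGNS, modulo `ClusterReady q ρ ∧ ClusterReadyNeg q ρ′`:** the only `q`-dial of `ζ` in
`ModulusRatioClass κ` (`0 ≤ κ < 1`, `κ < ρ`, `κ < ρ′`) is the trivial one. [folklore] -/
theorem dial_mem_modulusRatioClass_imp_trivial_of_clusterReady {q : ℕ} {ρ ρ' : ℝ} (h : ClusterReady q ρ)
    (h' : ClusterReadyNeg q ρ') {κ : ℝ} (hκ0 : 0 ≤ κ) (hκ : κ < 1) (hκρ : κ < ρ) (hκρ' : κ < ρ') {K : ℝ}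
    (hmem : datumOf (dial q K zetaWeights) ∈ ModulusRatioClass κ) : (K - 1) * zetaWeights q = 0 := by
  by_contra hne
  rcases lt_or_gt_of_ne hne with hlt | hgt
  · exact downDial_not_mem_modulusRatioClass_of_clusterReadyNeg h' hκ0 hκ hκρ' (K := K) (by linarith) hmem
  · exact upDial_not_mem_modulusRatioClass_of_clusterReady h hκ0 hκ hκρ (K := K) (by linarith) hmem

/-- **PROVED — FOR THE CARVER:** every class inside `ModulusRatioClass κ` misses every up-dial at `q`, modulo
`ClusterReady q ρ` only (`0 ≤ κ < 1`, `κ < ρ`). [folklore] -/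
theorem subset_modulusRatioClass_disjoint_upDials_of_clusterReady {S : Set Datum} {κ : ℝ}
    (hS : S ⊆ ModulusRatioClass κ) {q : ℕ} {ρ : ℝ} (h : ClusterReady q ρ) (hκ0 : 0 ≤ κ) (hκ : κ < 1)
    (hκρ : κ < ρ) {K : ℝ} (ht : 0 < 2 * (K - 1) * zetaWeights q) : datumOf (dial q K zetaWeights) ∉ S :=
  fun hmem => upDial_not_mem_modulusRatioClass_of_clusterReady h hκ0 hκ hκρ ht (hS hmem)

/-! ## §4 Finite stages never separate (W2, unconditional); `ζ`'s membership is the residue -/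

/-- **PROVED — a STRICT modulus-ratio class at finitely many windows (dimension `≥ 2`, `κ i ≥ 0`) containing `ζ`
strictly is `τ_unif`-ROBUST AT `ζ`** (`ε₁`, `ε₂` are `1`-Lipschitz in `τ_unif`). [folklore] -/
theorem uniformlyRobustAt_strictModulusRatio {k : ℕ} (W : Fin k → Window) (hW : ∀ i, 0 < (W i).N)
    {κ : Fin k → ℝ} (hκ : ∀ i, 0 ≤ κ i)
    (hζ : ∀ i, |bottomRayleigh (zetaDatum (W i))| < κ i * |secondRayleigh (zetaDatum (W i))|) :
    UniformlyRobustAt {d | ∀ i, |bottomRayleigh (d (W i))| < κ i * |secondRayleigh (d (W i))|} zetaDatum := by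
  set T : ℝ := ∑ j, κ j with hT_def
  have hTi : ∀ i, κ i ≤ T := fun i =>
    Finset.single_le_sum (f := κ) (fun j _ => hκ j) (Finset.mem_univ i)
  have hT : 0 ≤ T := Finset.sum_nonneg fun j _ => hκ j
  obtain ⟨ε, hε, hle⟩ := exists_eps_forall_le
    (γ := fun i => κ i * |secondRayleigh (zetaDatum (W i))| - |bottomRayleigh (zetaDatum (W i))|)
    (fun i => sub_pos.2 (hζ i)) (show (0 : ℝ) < 1 / (T + 1) by positivity)
  refine ⟨ε, hε, fun d hd i => ?_⟩
  have hμ : 0 < κ i * |secondRayleigh (zetaDatum (W i))| - |bottomRayleigh (zetaDatum (W i))| := sub_pos.2 (hζ i)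
  have h1 := abs_secondRayleigh_sub_le_of_uniformlyClose hd (W i) (hW i)
  have h2 := abs_bottomRayleigh_sub_le_of_uniformlyClose hd (W i)
  have h3 := hle i
  rw [div_le_iff₀ hμ] at h3
  -- `|ε₁(d)| ≤ |ε₁(ζ)| + ε`, `|ε₂(d)| ≥ |ε₂(ζ)| − ε`
  have h4 : |bottomRayleigh (d (W i))| ≤ |bottomRayleigh (zetaDatum (W i))| + ε := by
    have := abs_sub_abs_le_abs_sub (bottomRayleigh (d (W i))) (bottomRayleigh (zetaDatum (W i)))
    rw [abs_sub_comm] at h2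
    linarith
  have h5 : |secondRayleigh (zetaDatum (W i))| - ε ≤ |secondRayleigh (d (W i))| := by
    have := abs_sub_abs_le_abs_sub (secondRayleigh (zetaDatum (W i))) (secondRayleigh (d (W i)))
    linarith
  have h6 : κ i * |secondRayleigh (zetaDatum (W i))| - κ i * ε ≤ κ i * |secondRayleigh (d (W i))| := by
    have := mul_le_mul_of_nonneg_left h5 (hκ i)
    linarith [this]
  have h7 : (κ i + 1) * ε < κ i * |secondRayleigh (zetaDatum (W i))| - |bottomRayleigh (zetaDatum (W i))| := by
    have hTi' := hTi i
    have h8 : 2 * ε * (T + 1) ≤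
        κ i * |secondRayleigh (zetaDatum (W i))| - |bottomRayleigh (zetaDatum (W i))| := by
      have := h3; field_simp at this; linarith [this]
    nlinarith
  show |bottomRayleigh (d (W i))| < κ i * |secondRayleigh (d (W i))|
  nlinarith [hκ i]

/-- **PROVED — WALL W2 FOR STRICT MODULUS-RATIO CLASSES AT FINITELY MANY WINDOWS, UNCONDITIONAL:** a class
containing `{d | ∀ i, |ε₁(d; W i)| < κ i·|ε₂(d; W i)|}` (dimension `≥ 2`, `κ i ≥ 0`, `ζ` strictly inside) does
not separate `ζ` from the detectably negative data of any domain `⊇ arithDialSpace`. [folklore] -/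
theorem not_separates_of_strictModulusRatio_subset {k : ℕ} (W : Fin k → Window) (hW : ∀ i, 0 < (W i).N)
    {κ : Fin k → ℝ} (hκ : ∀ i, 0 ≤ κ i)
    (hζ : ∀ i, |bottomRayleigh (zetaDatum (W i))| < κ i * |secondRayleigh (zetaDatum (W i))|)
    {S D : Set Datum} (hS : {d | ∀ i, |bottomRayleigh (d (W i))| < κ i * |secondRayleigh (d (W i))|} ⊆ S)
    (hD : arithDialSpace ⊆ D) : ¬ Separates S D zetaDatum :=
  tally_not_separates_of_uniformlyRobust hD
    (let ⟨ε, hε, h⟩ := uniformlyRobustAt_strictModulusRatio W hW hκ hζ; ⟨ε, hε, fun d hd => hS (h d hd)⟩)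

/-- **PROVED — the residue:** a separating class inside `ModulusRatioClass κ` forces `|ε₁(ζ; w)| ≤ κ|ε₂(ζ; w)|`
at every window (a statement about `ζ` alone, sign-blind; not claimed). [folklore] -/
theorem zeta_mem_modulusRatioClass_of_separates {S D : Set Datum} {κ : ℝ} (hS : S ⊆ ModulusRatioClass κ)
    (hsep : Separates S D zetaDatum) :
    ∀ win, |bottomRayleigh (zetaDatum win)| ≤ κ * |secondRayleigh (zetaDatum win)| :=
  fun win => hS hsep.1 win

/-! ## §5 The PINCER conjunction `shape ∧ scale` at finite stages never separates (unconditional) -/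

/-- **PROVED — PINCER STAGE, gauge form:** the eigenspace-tolerance shape face at windows `W` (`τ_s > 0`) ∧ a strict
gauge-ratio stage at windows `W′` (dimension `≥ 2`, `τ i ≥ 0`, `ζ` strictly inside) — any class containing the
arithmetic part of this conjunction separates `ζ` from the negatives of no `D ⊇ arithDialSpace`. [folklore] -/
theorem not_separates_of_esTolerance_inter_strictGaugeRatio {k k' : ℕ} (W : Fin k → Window) {τs : ℝ}
    (hτs : 0 < τs) (W' : Fin k' → Window) (hW' : ∀ i, 0 < (W' i).N) {τ : Fin k' → ℝ} (hτ : ∀ i, 0 ≤ τ i)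
    (hζ : ∀ i, |bottomRayleigh (zetaDatum (W' i))| < τ i * bottomGapGauge zetaDatum (W' i)) {S D : Set Datum}
    (hS : esToleranceClass zetaDatum W τs ∩
      {d | ∀ i, |bottomRayleigh (d (W' i))| < τ i * bottomGapGauge d (W' i)} ∩ arithDialSpace ⊆ S)
    (hD : arithDialSpace ⊆ D) : ¬ Separates S D zetaDatum :=
  not_separates_of_robustWithin_arith hD
    ((((robustWithin_dialSpace_esToleranceClass_zeta W hτs).inter
      ((uniformlyRobustAt_strictGaugeRatio W' hW' hτ hζ).robustWithin dialSpace)).anti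
      arithDialSpace_subset_dialSpace).mono hS)

/-- **PROVED — PINCER STAGE, modulus form:** shape face ∧ strict modulus-ratio stage never separates. [folklore] -/
theorem not_separates_of_esTolerance_inter_strictModulusRatio {k k' : ℕ} (W : Fin k → Window) {τs : ℝ}
    (hτs : 0 < τs) (W' : Fin k' → Window) (hW' : ∀ i, 0 < (W' i).N) {κ : Fin k' → ℝ} (hκ : ∀ i, 0 ≤ κ i)
    (hζ : ∀ i, |bottomRayleigh (zetaDatum (W' i))| < κ i * |secondRayleigh (zetaDatum (W' i))|) {S D : Set Datum}
    (hS : esToleranceClass zetaDatum W τs ∩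
      {d | ∀ i, |bottomRayleigh (d (W' i))| < κ i * |secondRayleigh (d (W' i))|} ∩ arithDialSpace ⊆ S)
    (hD : arithDialSpace ⊆ D) : ¬ Separates S D zetaDatum :=
  not_separates_of_robustWithin_arith hD
    ((((robustWithin_dialSpace_esToleranceClass_zeta W hτs).inter
      ((uniformlyRobustAt_strictModulusRatio W' hW' hκ hζ).robustWithin dialSpace)).anti
      arithDialSpace_subset_dialSpace).mono hS)

end Summit.RiemannHypothesis.RiemannHypothesis.Theorems.PfPersistence

end
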